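import Literature.Analysis.Calculus.QuadraticMapKantorovich
import HarnessLib

/-!
# Isolation radius of the trivial zero of a quadratic map `x ↦ A x + Q x x`

`Literature/Analysis/Calculus`, corollary file of `QuadraticMapKantorovich.lean` (everything proved; no definitions, no named facts).
For a quadratic map `G x = A x + Q x x` (`A : X →L Y` boundedly invertible through `Φ : X ≃L Y`, `Q : X →L X →L Y` bounded
bilinear) the point `x = 0` is a zero, and every OTHER zero satisfies `x = -Φ⁻¹ (Q x x)`, hence `‖x‖ ≤ β ‖x‖²` for any constant
`β` with `‖Φ⁻¹ (Q u v)‖ ≤ β ‖u‖ ‖v‖`; so a nonzero zero has `‖x‖ ≥ 1/β`: the open ball of radius `1/β` about `0` contains no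
zero except `0` itself (`eq_zero_of_quadratic_zero_of_norm_lt`).  With the split constants `‖Φ⁻¹‖ ≤ K`, `‖Q u v‖ ≤ M ‖u‖ ‖v‖`
one may take `β = K M` (`one_le_mul_mul_norm_of_quadratic_zero`); this isolation radius `1/(K M)` is twice the uniqueness radius
`1/(K · 2M)` that the Newton–Kantorovich window `existsUnique_zero_of_kantorovich_quadratic_window` gives at `g₀ = 0`, `x̄ = 0`.

Elementary (one line of algebra); recorded because it is the statement behind «small-amplitude exclusion balls» of truncated
quadratic (Navier–Stokes-type) zero-finding problems: a float or interval bound `Ẑ ≥ 2‖Φ⁻¹ Q‖` on the composite bilinear map gives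
the certified isolation radius `r₀ = 2/Ẑ` in whatever norm `Ẑ` was measured (plain or weighted).  [cite: Deuflhard2011, §2.1.1
(affine-covariant Lipschitz constant `ω̄₀` of a quadratic map; uniqueness ball of Thm. 2.1)] — the composite constant `β` is the
affine-covariant one.  WHAT THIS IS NOT: nothing about Navier–Stokes; no statement about any particular truncation.
-/

noncomputable section

open Metric Set

namespace Literature.Analysis.Calculus

variable {X Y : Type*} [NormedAddCommGroup X] [NormedSpace ℝ X] [NormedAddCommGroup Y] [NormedSpace ℝ Y]

/-- **A nonzero zero of `x ↦ A x + Q x x` is represented as `x = -Φ⁻¹ (Q x x)`** when `Φ : X ≃L Y` realises `A`.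
[cite: Deuflhard2011, §2.1.1 (quadratic maps; fixed-point form of the Newton correction at the trivial solution)] -/
theorem eq_neg_symm_apply_of_quadratic_zero (A : X →L[ℝ] Y) (Q : X →L[ℝ] X →L[ℝ] Y) (Φ : X ≃L[ℝ] Y)
    (hΦ : (Φ : X →L[ℝ] Y) = A) {x : X} (hx : A x + Q x x = 0) : x = -(Φ.symm (Q x x)) := by
  have h1 : Φ x = -(Q x x) := by
    have h2 : (Φ : X →L[ℝ] Y) x = A x := by rw [hΦ]
    rw [ContinuousLinearEquiv.coe_coe] at h2
    rw [h2]
    exact eq_neg_of_add_eq_zero_left hx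
  calc x = Φ.symm (Φ x) := (Φ.symm_apply_apply x).symm
    _ = Φ.symm (-(Q x x)) := by rw [h1]
    _ = -(Φ.symm (Q x x)) := map_neg _ _

/-- **Isolation of the trivial zero of a quadratic map, composite (affine-covariant) constant.**  If `‖Φ⁻¹ (Q u v)‖ ≤ β ‖u‖ ‖v‖`
for all `u v` and `x ≠ 0` solves `A x + Q x x = 0` (`Φ` realising `A`), then `1 ≤ β ‖x‖`.
[cite: Deuflhard2011, §2.1.1 Thm. 2.1 (uniqueness ball; here at the trivial solution, with the composite constant)] -/
theorem one_le_mul_norm_of_quadratic_zero (A : X →L[ℝ] Y) (Q : X →L[ℝ] X →L[ℝ] Y) (Φ : X ≃L[ℝ] Y)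
    (hΦ : (Φ : X →L[ℝ] Y) = A) {β : ℝ} (hβ : ∀ u v, ‖Φ.symm (Q u v)‖ ≤ β * ‖u‖ * ‖v‖)
    {x : X} (hx : A x + Q x x = 0) (hx0 : x ≠ 0) : 1 ≤ β * ‖x‖ := by
  have hx' := eq_neg_symm_apply_of_quadratic_zero A Q Φ hΦ hx
  have hn : ‖x‖ ≤ β * ‖x‖ * ‖x‖ := by
    calc ‖x‖ = ‖-(Φ.symm (Q x x))‖ := congrArg (fun y => ‖y‖) hx'
      _ = ‖Φ.symm (Q x x)‖ := norm_neg _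
      _ ≤ β * ‖x‖ * ‖x‖ := hβ x x
  have hpos : 0 < ‖x‖ := norm_pos_iff.mpr hx0
  exact le_of_mul_le_mul_right (by rwa [one_mul]) hpos

/-- **Isolation radius `1/β`.**  Under the hypotheses of `one_le_mul_norm_of_quadratic_zero` with `0 < β`, a nonzero zero has
`1/β ≤ ‖x‖`. [cite: Deuflhard2011, §2.1.1 Thm. 2.1 (uniqueness ball at the trivial solution)] -/
theorem inv_le_norm_of_quadratic_zero (A : X →L[ℝ] Y) (Q : X →L[ℝ] X →L[ℝ] Y) (Φ : X ≃L[ℝ] Y)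
    (hΦ : (Φ : X →L[ℝ] Y) = A) {β : ℝ} (hβpos : 0 < β) (hβ : ∀ u v, ‖Φ.symm (Q u v)‖ ≤ β * ‖u‖ * ‖v‖)
    {x : X} (hx : A x + Q x x = 0) (hx0 : x ≠ 0) : 1 / β ≤ ‖x‖ := by
  have h := one_le_mul_norm_of_quadratic_zero A Q Φ hΦ hβ hx hx0
  rw [div_le_iff₀ hβpos, mul_comm]
  exact h

/-- **No nontrivial zero in the open ball of radius `1/β` about `0`** (the «small-amplitude exclusion ball» of a quadratic
zero-finding problem): if `‖Φ⁻¹ (Q u v)‖ ≤ β ‖u‖ ‖v‖`, `0 < β`, `A x + Q x x = 0` and `‖x‖ < 1/β`, then `x = 0`.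
[cite: Deuflhard2011, §2.1.1 Thm. 2.1 (uniqueness ball at the trivial solution)] -/
theorem eq_zero_of_quadratic_zero_of_norm_lt (A : X →L[ℝ] Y) (Q : X →L[ℝ] X →L[ℝ] Y) (Φ : X ≃L[ℝ] Y)
    (hΦ : (Φ : X →L[ℝ] Y) = A) {β : ℝ} (hβpos : 0 < β) (hβ : ∀ u v, ‖Φ.symm (Q u v)‖ ≤ β * ‖u‖ * ‖v‖)
    {x : X} (hx : A x + Q x x = 0) (hsmall : ‖x‖ < 1 / β) : x = 0 := by
  by_contra hx0
  exact absurd (inv_le_norm_of_quadratic_zero A Q Φ hΦ hβpos hβ hx hx0) (not_le.mpr hsmall)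

/-- **Split constants.**  With `‖Φ⁻¹‖ ≤ K` and `‖Q u v‖ ≤ M ‖u‖ ‖v‖` (`0 ≤ K`), a nonzero zero of `x ↦ A x + Q x x` has
`1 ≤ K M ‖x‖`; the isolation radius `1/(K M)` is twice the Newton–Kantorovich uniqueness radius `1/(K · 2M)` of
`existsUnique_zero_of_kantorovich_quadratic_window` at `g₀ = 0`, `x̄ = 0`.
[cite: Deuflhard2011, §2.1.1 Thm. 2.1 (with `ω̄₀ ≤ 2MK`; uniqueness ball)] -/
theorem one_le_mul_mul_norm_of_quadratic_zero (A : X →L[ℝ] Y) (Q : X →L[ℝ] X →L[ℝ] Y) (Φ : X ≃L[ℝ] Y)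
    (hΦ : (Φ : X →L[ℝ] Y) = A) {K M : ℝ} (hK0 : 0 ≤ K) (hK : ‖(Φ.symm : Y →L[ℝ] X)‖ ≤ K)
    (hM : ∀ u v, ‖Q u v‖ ≤ M * ‖u‖ * ‖v‖) {x : X} (hx : A x + Q x x = 0) (hx0 : x ≠ 0) :
    1 ≤ K * M * ‖x‖ := by
  have hβ : ∀ u v, ‖Φ.symm (Q u v)‖ ≤ K * M * ‖u‖ * ‖v‖ := by
    intro u v
    calc ‖Φ.symm (Q u v)‖ = ‖(Φ.symm : Y →L[ℝ] X) (Q u v)‖ := rfl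
      _ ≤ ‖(Φ.symm : Y →L[ℝ] X)‖ * ‖Q u v‖ := ContinuousLinearMap.le_opNorm _ _
      _ ≤ K * (M * ‖u‖ * ‖v‖) := mul_le_mul hK (hM u v) (norm_nonneg _) hK0
      _ = K * M * ‖u‖ * ‖v‖ := by ring
  exact one_le_mul_norm_of_quadratic_zero A Q Φ hΦ (β := K * M) hβ hx hx0

end Literature.Analysis.Calculus

end
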